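import Literature.MathematicalPhysics.QuantumLattice.GroundStateInfraredBoundEveryState
import HarnessLib

/-!
# The Kennedy–Lieb–Shastry ground-state infrared bound from Gaussian domination at ONE PAIR of finite source strengths, with a certified slack

Kennedy–Lieb–Shastry (J. Stat. Phys. 53 (1988) 1019, eqs. (12)–(14) and (18)–(19); read in
E. H. Lieb, *Statistical Mechanics (Selecta)*, paper IV.7, pp. 1024–1027) derive the ground-state
infrared bound from Gaussian domination in its ENERGY form `(GD_V,Q): E₀(H) ≤ E₀(H + tV + ½t²Q)` by
"second-order perturbation theory done variationally": the trial family `(1 + tμV)P₀` is inserted into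
`H + tV − E₀(H + tV) ≥ 0` and only the germ at `t = 0` (eq. (19), `d²E(λh)/dλ²|₀ ≥ 0`) is consumed.
The tree has this in three forms — tracial (`Matrix.groundState_infraredBound`,
`XYOrderInfraredProofs.lean`), every ground-supported state under the global hypothesis
(`GroundStateInfraredBoundEveryState.lean`), and under the LOCAL hypothesis "for all `|t| ≤ t₀`"
(`GroundStateInfraredBoundLocalSource.lean`) — all of which use the `t → 0` germ, i.e. a
susceptibility ceiling.

This file runs the SAME printed argument at a FIXED pair of source strengths `±t₀` and with a SLACK
`s ≥ 0` in the energy inequality — the shape in which a certified computation delivers Gaussian-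
domination-type input: two certified numbers
`E₀(H) ≤ E₀(H ± t₀V) + ½t₀²Q + s` (a certified UPPER bound on `E₀(H)` against certified LOWER bounds
on the two sourced ground energies, `Q` the quadratic allowance, `s` the total certified slack). Adding
the two trial inequalities at `+t₀` (trial parameter `μt₀`) and `−t₀` (trial parameter `−μt₀`) cancels
the odd terms `t·tr(ρV)·(…)` and `t³·tr(ρV³)` exactly, and what is left is the KLS quadratic form
with EXPLICIT finite-source corrections (no limit is taken anywhere):

* `infraredBound_quadratic_of_finiteSource`: for every `ρ ⪰ 0` with `Hρ = E₀ρ` and centred mode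
  `Re tr(ρV) = 0`, and every real `μ`,
  `0 ≤ (½Q + s/t₀²)·Re trρ + 2μ·Re tr(ρV²) + μ²·[Re tr(ρV(H−E₀)V) + (½Qt₀² + s)·Re tr(ρV²)]`;
* `infraredBound_of_finiteSource` (discriminant):
  `(Re tr ρV²)² ≤ (½Q + s/t₀²)·Re trρ·[Re tr(ρV(H−E₀)V) + (½Qt₀² + s)·Re tr(ρV²)]`, and its
  double-commutator form `infraredBound_doubleCommutator_of_finiteSource`
  (`Re tr(ρV(H−E₀)V) = ½Re tr(ρ[V,[H,V]])`, KLS (13));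
* `trace_sq_le_of_finiteSource` — THE CERTIFIED-INPUT MODE CEILING: for a ground-supported density
  matrix (`tr ρ = 1`), `Q, s ≥ 0` and a double-commutator ceiling `Re tr(ρ[V,[H,V]]) ≤ D`,
  `Re tr(ρV²) ≤ ½√(Q_eff·D) + ¼·Q_eff·(Qt₀² + 2s)`, `Q_eff := Q + 2s/t₀²`.
  At `s = o(t₀²)`, `t₀ → 0` this is Kennedy–Lieb–Shastry's `½√(QD)` (the tree's
  `trace_sq_le_half_sqrt_of_groundSupported`); at finite `(t₀, s)` the two corrections are explicit:
  the slack enters as `2s/t₀²` added to `Q`, and the finite source as the additive term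
  `¼Q_eff(Qt₀² + 2s)`. In the Kennedy–Lieb–Shastry application (`V` = a spin or pair-field wave of
  wave vector `k ≠ 0` on `|Λ|` sites, `Q`, `D`, `Re tr(ρV²)` all of order `|Λ|`) the main term is
  `O(|Λ|)` and the additive correction is `O(|Λ|²t₀² + |Λ|s)`: the bound is informative when the
  source amplitude satisfies `t₀²|Λ| ≲ 1` and the TOTAL energy slack `s` is `O(1)` — the volume price
  of consuming Gaussian domination at finite source strength through this trial family is on the
  face of the formula (no uniformity in the volume at fixed `t₀`);
* tracial and vector packagings: `groundState_infraredBound_of_finiteSource` (`ρ = P₀`, the tree's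
  `Matrix.groundStateFunctional`; centring `Re ω(V) = 0`) and `infraredBound_of_mulVec_eq_finiteSource`
  (any vector `ψ` with `Hψ = E₀ψ` and `Re⟨ψ,Vψ⟩ = 0`).

* the ASSEMBLY with a sum rule (Kennedy–Lieb–Shastry (2)–(4) in finite volume):
  `trace_orderingMode_ge_of_sumRule` / `trace_orderingMode_ge_of_finiteSource` — a sum-rule floor
  `S_tot ≤ Re tr(ρV_{i₀}²) + Σ_{i∈s} Re tr(ρV_i²)` and the certified data `(t_i, Q_i, s_i, D_i)` of
  finitely many centred modes give the FLOOR
  `Re tr(ρV_{i₀}²) ≥ S_tot − Σ_{i∈s}[½√(Q_eff,i D_i) + ¼Q_eff,i(Q_i t_i² + 2s_i)]` on the ordering mode.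

Centring (`Re tr(ρV) = 0`, KLS's `⟨V⟩ = 0`) is a HYPOTHESIS here: under the global hypothesis it is a
consequence (`trace_mul_eq_zero_of_gaussianDomination`), but two finite-`t` inequalities do not force
it; in the applications it holds by a symmetry of `ρ` (translation invariance for `k ≠ 0` modes, a
spin flip or the `U(1)` quarter turn for pair fields). All results are PROVED; no definition, no named
fact. NOT here: no claim that the two-point hypothesis holds for any model (for reflection-positive
models it is Dyson–Lieb–Simon / Kennedy–Lieb–Shastry Gaussian domination with `s = 0` at every `t`;
for a doped lattice-fermion model it is an INPUT to be certified), no sum rule, no lattice Fourier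
analysis.

## References
* T. Kennedy, E. H. Lieb, B. S. Shastry, *Existence of Néel order in some spin-½ Heisenberg
  antiferromagnets*, J. Stat. Phys. 53 (1988) 1019–1030 [KLS1988JSP], eqs. (2)–(4), (12)–(14),
  (18)–(19) (Lieb Selecta *Statistical Mechanics*, paper IV.7, pp. 1020–1027, read).
* F. J. Dyson, E. H. Lieb, B. Simon, J. Stat. Phys. 18 (1978) 335–383 [DysonLiebSimon1978], §3
  (the positive-temperature transfer this replaces at `T = 0`).
-/

noncomputable section

open Matrix Finset Filter Topology
open scoped ComplexOrder

namespace Literature.MathematicalPhysics.QuantumLattice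

variable {m : Type*} [Fintype m] [DecidableEq m]

section GroundSupported
variable {H V ρ : Matrix m m ℂ}

/-- `ρ(H − E₀) = 0` from `Hρ = E₀ρ` for Hermitian `H`, `ρ`. [folklore] -/
private theorem mul_eq_smul_of_hermitian' (hH : H.IsHermitian) (hρ : ρ.IsHermitian)
    (hHρ : H * ρ = (H.groundEnergy : ℂ) • ρ) : ρ * H = (H.groundEnergy : ℂ) • ρ := by
  have h := congrArg conjTranspose hHρ
  rw [conjTranspose_mul, conjTranspose_smul, hρ.eq, hH.eq, Complex.star_def,
    Complex.conj_ofReal] at h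
  exact h

/-- `Re tr(ρV²) ≥ 0` for `ρ ⪰ 0` and Hermitian `V`. [folklore] -/
private theorem re_trace_mul_sq_nonneg (hV : V.IsHermitian) (hρ : ρ.PosSemidef) :
    0 ≤ (ρ * (V * V)).trace.re := by
  have hVV : (V * V).PosSemidef := by
    simpa only [hV.eq] using posSemidef_conjTranspose_mul_self V
  exact Literature.LinearAlgebra.Matrix.re_trace_mul_nonneg_of_posSemidef hρ hVV

/-- `Re tr(ρ V(H−E₀)V) ≥ 0` for `ρ ⪰ 0`, Hermitian `H`, `V` (`H − E₀ ⪰ 0`). [folklore] -/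
private theorem re_trace_mul_conj_sub_groundEnergy_nonneg (hH : H.IsHermitian) (hV : V.IsHermitian)
    (hρ : ρ.PosSemidef) :
    0 ≤ (ρ * (V * (H - (H.groundEnergy : ℂ) • 1) * V)).trace.re := by
  have hK : (H - (H.groundEnergy : ℂ) • (1 : Matrix m m ℂ)).PosSemidef :=
    posSemidef_sub_of_groundEnergy_le hH le_rfl
  have hVKV : (V * (H - (H.groundEnergy : ℂ) • 1) * V).PosSemidef := by
    have h := hK.conjTranspose_mul_mul_same V
    rwa [hV.eq] at h
  exact Literature.LinearAlgebra.Matrix.re_trace_mul_nonneg_of_posSemidef hρ hVKV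

/-- **The trial inequality at one source strength with an allowance** (Kennedy–Lieb–Shastry's
variational step, eqs. (18)–(19), before any limit): if `E₀(H) ≤ E₀(H + tV + c)` for ONE real `t` and
a real allowance `c`, then for every `ρ ⪰ 0` with `Hρ = E₀ρ` and every real trial parameter `σ`,
`0 ≤ t·Re tr(ρV) + c·Re trρ + 2σ(t·Re tr(ρV²) + c·Re tr(ρV)) + σ²(Re tr(ρV(H−E₀)V) + t·Re tr(ρV³) +
c·Re tr(ρV²))` — the positive operator `H − E₀ + tV + c` in the positive functional
`tr((1+σV)ρ(1+σV) ·)`. [cite: KLS1988JSP, eqs. (18)–(19)] -/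
theorem kls_trial_poly_nonneg_of_allowance (hH : H.IsHermitian) (hV : V.IsHermitian)
    (hρ : ρ.PosSemidef) (hHρ : H * ρ = (H.groundEnergy : ℂ) • ρ) {t c : ℝ}
    (hGD : H.groundEnergy ≤ (H + (t : ℂ) • V + (c : ℂ) • (1 : Matrix m m ℂ)).groundEnergy) (σ : ℝ) :
    0 ≤ t * (ρ * V).trace.re + c * ρ.trace.re +
      (2 * σ) * (t * (ρ * (V * V)).trace.re + c * (ρ * V).trace.re) +
      σ ^ 2 * ((ρ * (V * (H - (H.groundEnergy : ℂ) • 1) * V)).trace.re +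
        t * (ρ * (V * V * V)).trace.re + c * (ρ * (V * V)).trace.re) := by
  set K : Matrix m m ℂ := H - (H.groundEnergy : ℂ) • 1 with hK_def
  have hKρ : K * ρ = 0 := by
    rw [hK_def, sub_mul, hHρ, Matrix.smul_mul, one_mul, sub_self]
  have hρK : ρ * K = 0 := by
    rw [hK_def, mul_sub, mul_eq_smul_of_hermitian' hH hρ.1 hHρ, Matrix.mul_smul, mul_one, sub_self]
  -- `M = K + tV + c ⪰ 0`
  have hM : (K + (t : ℂ) • V + (c : ℂ) • (1 : Matrix m m ℂ)).PosSemidef := by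
    have hX : (H + (t : ℂ) • V + (c : ℂ) • (1 : Matrix m m ℂ)).IsHermitian :=
      (hH.add (hV.ofReal_smul t)).add (isHermitian_one.ofReal_smul _)
    have h := posSemidef_sub_of_groundEnergy_le hX hGD
    convert h using 1
    rw [hK_def]
    abel
  -- `(1 + σV) ρ (1 + σV) ⪰ 0`
  have hS : ((1 + (σ : ℂ) • V) * ρ * (1 + (σ : ℂ) • V)).PosSemidef := by
    have h := hρ.mul_mul_conjTranspose_same (1 + (σ : ℂ) • V)
    rwa [conjTranspose_add, conjTranspose_one, conjTranspose_smul, hV.eq, Complex.star_def,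
      Complex.conj_ofReal] at h
  have h0 := Literature.LinearAlgebra.Matrix.re_trace_mul_nonneg_of_posSemidef hS hM
  rw [trace_conj_trial_mul_expansion hKρ hρK t σ c] at h0
  simpa only [Complex.add_re, Complex.re_ofReal_mul] using h0

variable {t₀ Q s : ℝ}

/-- **Second-order perturbation theory at a finite pair of source strengths, in every centred ground
state.** Let `H`, `V` be Hermitian, `ρ ⪰ 0` with `Hρ = E₀ρ` and `Re tr(ρV) = 0`, `t₀ ≠ 0`, and suppose
the TWO energy inequalities `E₀(H) ≤ E₀(H ± t₀V) + ½t₀²Q + s` (Gaussian domination at `±t₀` with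
slack `s`). Then for every real `μ`,
`0 ≤ (½Q + s/t₀²)·Re trρ + 2μ·Re tr(ρV²) + μ²·[Re tr(ρV(H−E₀)V) + (½Qt₀² + s)·Re tr(ρV²)]`.
Proof: the sum of `kls_trial_poly_nonneg_of_allowance` at `(t₀, μt₀)` and `(−t₀, −μt₀)` (odd terms
cancel), divided by `2t₀²`. Kennedy–Lieb–Shastry's (19) is the `t₀ → 0`, `s = 0` germ of this.
[cite: KLS1988JSP, eqs. (18)–(19)] -/
theorem infraredBound_quadratic_of_finiteSource (hH : H.IsHermitian) (hV : V.IsHermitian)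
    (hρ : ρ.PosSemidef) (hHρ : H * ρ = (H.groundEnergy : ℂ) • ρ) (hcent : (ρ * V).trace.re = 0)
    (ht₀ : t₀ ≠ 0)
    (hGDp : H.groundEnergy ≤
      (H + (t₀ : ℂ) • V + ((t₀ ^ 2 * Q / 2 + s : ℝ) : ℂ) • (1 : Matrix m m ℂ)).groundEnergy)
    (hGDm : H.groundEnergy ≤
      (H - (t₀ : ℂ) • V + ((t₀ ^ 2 * Q / 2 + s : ℝ) : ℂ) • (1 : Matrix m m ℂ)).groundEnergy)
    (μ : ℝ) :
    0 ≤ (Q / 2 + s / t₀ ^ 2) * ρ.trace.re + 2 * μ * (ρ * (V * V)).trace.re +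
      μ ^ 2 * ((ρ * (V * (H - (H.groundEnergy : ℂ) • 1) * V)).trace.re +
        (t₀ ^ 2 * Q / 2 + s) * (ρ * (V * V)).trace.re) := by
  set c : ℝ := t₀ ^ 2 * Q / 2 + s with hc
  set a : ℝ := (ρ * (V * V)).trace.re with ha
  set b : ℝ := (ρ * (V * (H - (H.groundEnergy : ℂ) • 1) * V)).trace.re with hb
  set a₃ : ℝ := (ρ * (V * V * V)).trace.re with ha₃
  set n : ℝ := ρ.trace.re with hn
  have hp := kls_trial_poly_nonneg_of_allowance hH hV hρ hHρ hGDp (μ * t₀)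
  have hGDm' : H.groundEnergy ≤
      (H + (((-t₀ : ℝ)) : ℂ) • V + (c : ℂ) • (1 : Matrix m m ℂ)).groundEnergy := by
    rw [Complex.ofReal_neg, neg_smul, ← sub_eq_add_neg]
    exact hGDm
  have hq := kls_trial_poly_nonneg_of_allowance hH hV hρ hHρ hGDm' (-(μ * t₀))
  rw [hcent] at hp hq
  have ht2 : 0 < t₀ ^ 2 := by positivity
  -- the sum of the two inequalities is `2 c n + 4 μ t₀² a + 2 μ² t₀² (b + c a) ≥ 0`
  have key : 0 ≤ c * n + 2 * μ * t₀ ^ 2 * a + μ ^ 2 * t₀ ^ 2 * (b + c * a) := by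
    nlinarith [hp, hq]
  have hr : s / t₀ ^ 2 * t₀ ^ 2 = s := div_mul_cancel₀ s ht2.ne'
  have hcn : t₀ ^ 2 * (Q / 2 + s / t₀ ^ 2) = c := by
    rw [mul_add, mul_comm (t₀ ^ 2) (s / t₀ ^ 2), hr, hc]
    ring
  refine (mul_nonneg_iff_of_pos_left ht2).1 ?_
  have hEq : t₀ ^ 2 * ((Q / 2 + s / t₀ ^ 2) * n + 2 * μ * a + μ ^ 2 * (b + c * a)) =
      (t₀ ^ 2 * (Q / 2 + s / t₀ ^ 2)) * n + 2 * μ * t₀ ^ 2 * a + μ ^ 2 * t₀ ^ 2 * (b + c * a) := by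
    ring
  rw [hEq, hcn]
  exact key

/-- **The ground-state infrared bound from a finite pair of source strengths** (every centred
ground-supported state): under the two inequalities `E₀(H) ≤ E₀(H ± t₀V) + ½t₀²Q + s`,
`(Re tr ρV²)² ≤ (½Q + s/t₀²)·Re trρ·[Re tr(ρV(H−E₀)V) + (½Qt₀² + s)·Re tr(ρV²)]` — the discriminant
of `infraredBound_quadratic_of_finiteSource`; Kennedy–Lieb–Shastry's Cauchy–Schwarz step (12) with
the susceptibility bound (14), now with the finite-source and slack corrections explicit.
[cite: KLS1988JSP, eqs. (12), (14), (18)–(19)] -/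
theorem infraredBound_of_finiteSource (hH : H.IsHermitian) (hV : V.IsHermitian)
    (hρ : ρ.PosSemidef) (hHρ : H * ρ = (H.groundEnergy : ℂ) • ρ) (hcent : (ρ * V).trace.re = 0)
    (ht₀ : t₀ ≠ 0)
    (hGDp : H.groundEnergy ≤
      (H + (t₀ : ℂ) • V + ((t₀ ^ 2 * Q / 2 + s : ℝ) : ℂ) • (1 : Matrix m m ℂ)).groundEnergy)
    (hGDm : H.groundEnergy ≤
      (H - (t₀ : ℂ) • V + ((t₀ ^ 2 * Q / 2 + s : ℝ) : ℂ) • (1 : Matrix m m ℂ)).groundEnergy) :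
    (ρ * (V * V)).trace.re ^ 2 ≤
      (Q / 2 + s / t₀ ^ 2) * ρ.trace.re *
        ((ρ * (V * (H - (H.groundEnergy : ℂ) • 1) * V)).trace.re +
          (t₀ ^ 2 * Q / 2 + s) * (ρ * (V * V)).trace.re) := by
  have hq : ∀ x : ℝ, 0 ≤ ((ρ * (V * (H - (H.groundEnergy : ℂ) • 1) * V)).trace.re +
      (t₀ ^ 2 * Q / 2 + s) * (ρ * (V * V)).trace.re) * (x * x) +
      2 * (ρ * (V * V)).trace.re * x + (Q / 2 + s / t₀ ^ 2) * ρ.trace.re := by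
    intro x
    have h := infraredBound_quadratic_of_finiteSource hH hV hρ hHρ hcent ht₀ hGDp hGDm x
    linarith [h]
  have hd := discrim_le_zero hq
  rw [discrim] at hd
  nlinarith [hd]

/-- **Double-commutator form** (Kennedy–Lieb–Shastry (12)–(13) with the finite-source corrections):
`(Re tr ρV²)² ≤ (½Q + s/t₀²)·Re trρ·[½Re tr(ρ[V,[H,V]]) + (½Qt₀² + s)·Re tr(ρV²)]`,
`[V,[H,V]] = V(HV − VH) − (HV − VH)V`. [cite: KLS1988JSP, eqs. (12)–(13)] -/
theorem infraredBound_doubleCommutator_of_finiteSource (hH : H.IsHermitian) (hV : V.IsHermitian)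
    (hρ : ρ.PosSemidef) (hHρ : H * ρ = (H.groundEnergy : ℂ) • ρ) (hcent : (ρ * V).trace.re = 0)
    (ht₀ : t₀ ≠ 0)
    (hGDp : H.groundEnergy ≤
      (H + (t₀ : ℂ) • V + ((t₀ ^ 2 * Q / 2 + s : ℝ) : ℂ) • (1 : Matrix m m ℂ)).groundEnergy)
    (hGDm : H.groundEnergy ≤
      (H - (t₀ : ℂ) • V + ((t₀ ^ 2 * Q / 2 + s : ℝ) : ℂ) • (1 : Matrix m m ℂ)).groundEnergy) :
    (ρ * (V * V)).trace.re ^ 2 ≤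
      (Q / 2 + s / t₀ ^ 2) * ρ.trace.re *
        ((1 / 2 : ℝ) * (ρ * (V * (H * V - V * H) - (H * V - V * H) * V)).trace.re +
          (t₀ ^ 2 * Q / 2 + s) * (ρ * (V * V)).trace.re) := by
  have h := infraredBound_of_finiteSource hH hV hρ hHρ hcent ht₀ hGDp hGDm
  rwa [trace_mul_sub_mul_eq_half_doubleCommutator hHρ (mul_eq_smul_of_hermitian' hH hρ.1 hHρ),
    show (1 / 2 : ℂ) = ((1 / 2 : ℝ) : ℂ) by push_cast; ring, Complex.re_ofReal_mul] at h

/-- Elementary: `a² ≤ βa + S²` with `a, β, S ≥ 0` forces `a ≤ β + S`. [folklore] -/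
private theorem le_add_of_sq_le {a β S : ℝ} (hβ : 0 ≤ β) (hS : 0 ≤ S)
    (h : a ^ 2 ≤ β * a + S ^ 2) : a ≤ β + S := by
  by_contra hlt
  have hlt' : β + S < a := not_le.mp hlt
  -- `a − β > S ≥ 0`, so `a(a − β) ≥ (a − β)² > S²`
  nlinarith [mul_pos (by linarith : 0 < a - β - S) (by linarith : 0 < a - β + S),
    mul_nonneg hβ (by linarith : 0 ≤ a - β)]

/-- **Certified-input mode ceiling at finite source strength.** For a ground-supported density matrix
(`ρ ⪰ 0`, `Hρ = E₀ρ`, `tr ρ = 1`) with centred mode `Re tr(ρV) = 0`, constants `Q, s ≥ 0`, `t₀ ≠ 0`,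
the two certified energy inequalities `E₀(H) ≤ E₀(H ± t₀V) + ½t₀²Q + s`, and a double-commutator
ceiling `Re tr(ρ[V,[H,V]]) ≤ D`, one has, with `Q_eff = Q + 2s/t₀²`,
`Re tr(ρV²) ≤ ½√(Q_eff·D) + ¼·Q_eff·(Qt₀² + 2s)`.
The first term is Kennedy–Lieb–Shastry's `½√(QD)` with the slack folded into `Q`; the second is the
finite-source correction (absent in the `t₀ → 0` germ, `trace_sq_le_half_sqrt_of_groundSupported`).
From finitely many certified numbers `(t₀, Q, s, D)`; no limit. [cite: KLS1988JSP, eqs. (12)–(14)] -/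
theorem trace_sq_le_of_finiteSource (hH : H.IsHermitian) (hV : V.IsHermitian)
    (hρ : ρ.PosSemidef) (hHρ : H * ρ = (H.groundEnergy : ℂ) • ρ) (htr : ρ.trace = 1)
    (hcent : (ρ * V).trace.re = 0) (ht₀ : t₀ ≠ 0) (hQ : 0 ≤ Q) (hs : 0 ≤ s)
    (hGDp : H.groundEnergy ≤
      (H + (t₀ : ℂ) • V + ((t₀ ^ 2 * Q / 2 + s : ℝ) : ℂ) • (1 : Matrix m m ℂ)).groundEnergy)
    (hGDm : H.groundEnergy ≤
      (H - (t₀ : ℂ) • V + ((t₀ ^ 2 * Q / 2 + s : ℝ) : ℂ) • (1 : Matrix m m ℂ)).groundEnergy)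
    {D : ℝ} (hD : (ρ * (V * (H * V - V * H) - (H * V - V * H) * V)).trace.re ≤ D) :
    (ρ * (V * V)).trace.re ≤
      Real.sqrt ((Q + 2 * s / t₀ ^ 2) * D) / 2 + (Q + 2 * s / t₀ ^ 2) * (Q * t₀ ^ 2 + 2 * s) / 4 := by
  have h := infraredBound_of_finiteSource hH hV hρ hHρ hcent ht₀ hGDp hGDm
  rw [htr, Complex.one_re, mul_one] at h
  set a : ℝ := (ρ * (V * V)).trace.re with ha_def
  set b : ℝ := (ρ * (V * (H - (H.groundEnergy : ℂ) • 1) * V)).trace.re with hb_def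
  have ha : 0 ≤ a := re_trace_mul_sq_nonneg hV hρ
  have hb : 0 ≤ b := re_trace_mul_conj_sub_groundEnergy_nonneg hH hV hρ
  -- `b = ½ Re tr(ρ[V,[H,V]]) ≤ D/2`, in particular `0 ≤ D`
  have hbD : 2 * b = (ρ * (V * (H * V - V * H) - (H * V - V * H) * V)).trace.re := by
    have h1 := trace_mul_sub_mul_eq_half_doubleCommutator (V := V) hHρ
      (mul_eq_smul_of_hermitian' hH hρ.1 hHρ)
    rw [show (1 / 2 : ℂ) = ((1 / 2 : ℝ) : ℂ) by push_cast; ring] at h1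
    have h2 := congrArg Complex.re h1
    rw [Complex.re_ofReal_mul] at h2
    rw [hb_def, h2]
    ring
  have hbD' : b ≤ D / 2 := by linarith
  have hD0 : 0 ≤ D := by linarith
  have ht2 : 0 < t₀ ^ 2 := by positivity
  set α : ℝ := Q / 2 + s / t₀ ^ 2 with hα_def
  set β : ℝ := t₀ ^ 2 * Q / 2 + s with hβ_def
  have hα : 0 ≤ α := add_nonneg (by linarith) (div_nonneg hs ht2.le)
  have hβ : 0 ≤ β := add_nonneg (by nlinarith) hs
  -- `a² ≤ α (b + β a) ≤ (αβ) a + α D / 2`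
  have h1 : a ^ 2 ≤ (α * β) * a + α * D / 2 := by
    have : α * b ≤ α * (D / 2) := mul_le_mul_of_nonneg_left hbD' hα
    nlinarith [h, this]
  -- `S = ½ √(Q_eff D)`, `S² = α D / 2`
  set S : ℝ := Real.sqrt ((Q + 2 * s / t₀ ^ 2) * D) / 2 with hS_def
  have hS : 0 ≤ S := div_nonneg (Real.sqrt_nonneg _) (by norm_num)
  have hQeff : Q + 2 * s / t₀ ^ 2 = 2 * α := by rw [hα_def]; ring
  have hS2 : S ^ 2 = α * D / 2 := by
    rw [hS_def, div_pow, Real.sq_sqrt (mul_nonneg (by linarith) hD0), hQeff]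
    ring
  have h2 : a ^ 2 ≤ (α * β) * a + S ^ 2 := by rw [hS2]; exact h1
  have h3 := le_add_of_sq_le (mul_nonneg hα hβ) hS h2
  have hE : (Q + 2 * s / t₀ ^ 2) * (Q * t₀ ^ 2 + 2 * s) / 4 = α * β := by
    rw [hQeff, hβ_def]; ring
  rw [hE]
  linarith [h3]

end GroundSupported

/-! ### Packagings: the tracial ground state and ground-state vectors -/

section Tracial
variable [Nonempty m] {H V : Matrix m m ℂ} {t₀ Q s : ℝ}

/-- `Re ω(O) = Re tr(P₀O) / Re tr P₀` for the tracial ground-state functional of a Hermitian matrix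
(`tr P₀ > 0` is real). [folklore] -/
private theorem re_groundStateFunctional_eq_div (hH : H.IsHermitian) (O : Matrix m m ℂ) :
    (H.groundStateFunctional O).re = (H.groundProj * O).trace.re / H.groundProj.trace.re := by
  have hpos := trace_groundProj_pos hH
  have hre : H.groundProj.trace = ((H.groundProj.trace.re : ℝ) : ℂ) :=
    Complex.ext (by simp) (by rw [Complex.ofReal_im]; exact ((Complex.pos_iff.mp hpos).2).symm)
  have hinv : (H.groundProj.trace)⁻¹ = (((H.groundProj.trace.re)⁻¹ : ℝ) : ℂ) := by
    rw [Complex.ofReal_inv, ← hre]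
  rw [groundStateFunctional_apply, hinv, Complex.re_ofReal_mul, div_eq_inv_mul]

/-- **The finite-source infrared bound for the tracial ground state** `ω = tr(P₀ ·)/tr P₀`
(`Matrix.groundStateFunctional`, the state of the tree's Kennedy–Lieb–Shastry chain): for Hermitian
`H`, `V` with `Re ω(V) = 0`, `t₀ ≠ 0` and `E₀(H) ≤ E₀(H ± t₀V) + ½t₀²Q + s`,
`ω(V²)² ≤ (½Q + s/t₀²)·[ω(V(H−E₀)V) + (½Qt₀² + s)·ω(V²)]` (real parts). At `s = 0`, `t₀ → 0` this is
the tree's `Matrix.groundState_infraredBound`. [cite: KLS1988JSP, eqs. (12), (14), (18)–(19)] -/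
theorem groundState_infraredBound_of_finiteSource (hH : H.IsHermitian) (hV : V.IsHermitian)
    (hcent : (H.groundStateFunctional V).re = 0) (ht₀ : t₀ ≠ 0)
    (hGDp : H.groundEnergy ≤
      (H + (t₀ : ℂ) • V + ((t₀ ^ 2 * Q / 2 + s : ℝ) : ℂ) • (1 : Matrix m m ℂ)).groundEnergy)
    (hGDm : H.groundEnergy ≤
      (H - (t₀ : ℂ) • V + ((t₀ ^ 2 * Q / 2 + s : ℝ) : ℂ) • (1 : Matrix m m ℂ)).groundEnergy) :
    (H.groundStateFunctional (V * V)).re ^ 2 ≤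
      (Q / 2 + s / t₀ ^ 2) *
        ((H.groundStateFunctional (V * (H - (H.groundEnergy : ℂ) • 1) * V)).re +
          (t₀ ^ 2 * Q / 2 + s) * (H.groundStateFunctional (V * V)).re) := by
  have hn : 0 < H.groundProj.trace.re := (Complex.pos_iff.mp (trace_groundProj_pos hH)).1
  have hcent' : (H.groundProj * V).trace.re = 0 := by
    have h := re_groundStateFunctional_eq_div hH V
    rw [hcent] at h
    have h' : (H.groundProj * V).trace.re / H.groundProj.trace.re = 0 := h.symm
    rcases div_eq_zero_iff.1 h' with h'' | h''
    · exact h''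
    · exact absurd h'' hn.ne'
  have h := infraredBound_of_finiteSource hH hV (posSemidef_groundProj H) (mul_groundProj H) hcent'
    ht₀ hGDp hGDm
  simp only [re_groundStateFunctional_eq_div hH]
  -- abbreviate the three traces and the normalisation
  set n : ℝ := H.groundProj.trace.re with hn_def
  set a : ℝ := (H.groundProj * (V * V)).trace.re with ha_def
  set b : ℝ := (H.groundProj * (V * (H - (H.groundEnergy : ℂ) • 1) * V)).trace.re with hb_def
  -- `a/n`, `b/n` in terms of `a`, `b`
  have ha' : a / n * n = a := div_mul_cancel₀ a hn.ne'
  have hb' : b / n * n = b := div_mul_cancel₀ b hn.ne'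
  have hn2 : 0 < n ^ 2 := by positivity
  refine le_of_mul_le_mul_right ?_ hn2
  have hL : (a / n) ^ 2 * n ^ 2 = a ^ 2 := by
    rw [div_pow, div_mul_cancel₀ _ hn2.ne']
  have hR : (Q / 2 + s / t₀ ^ 2) * (b / n + (t₀ ^ 2 * Q / 2 + s) * (a / n)) * n ^ 2 =
      (Q / 2 + s / t₀ ^ 2) * n * (b / n * n + (t₀ ^ 2 * Q / 2 + s) * (a / n * n)) := by ring
  rw [hL, hR, ha', hb']
  exact h

end Tracial

section Vector
variable {H V : Matrix m m ℂ} {t₀ Q s : ℝ} {ψ : m → ℂ}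

omit [DecidableEq m] in
/-- `Tr((x y) M) = y ⬝ (M x)`. [folklore] -/
private theorem trace_vecMulVec_mul' (x y : m → ℂ) (M : Matrix m m ℂ) :
    (vecMulVec x y * M).trace = y ⬝ᵥ (M *ᵥ x) := by
  simp only [Matrix.trace, Matrix.diag_apply, Matrix.mul_apply, vecMulVec_apply, dotProduct,
    mulVec, Finset.mul_sum]
  rw [Finset.sum_comm]
  refine Finset.sum_congr rfl fun j _ => Finset.sum_congr rfl fun i _ => ?_
  ring

omit [DecidableEq m] in
/-- `A (x y) = (A x) y`. [folklore] -/
private theorem mul_vecMulVec_eq' (A : Matrix m m ℂ) (x y : m → ℂ) :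
    A * vecMulVec x y = vecMulVec (A *ᵥ x) y := by
  ext i j
  simp only [Matrix.mul_apply, vecMulVec_apply, mulVec, dotProduct, Finset.sum_mul]
  refine Finset.sum_congr rfl fun k _ => ?_
  ring

/-- **The finite-source infrared bound for a ground-state vector**: for any `ψ` with `Hψ = E₀ψ` (a
vector of a possibly degenerate ground level) and `Re⟨ψ, Vψ⟩ = 0`, under
`E₀(H) ≤ E₀(H ± t₀V) + ½t₀²Q + s`,
`(Re⟨ψ, V²ψ⟩)² ≤ (½Q + s/t₀²)·Re⟨ψ,ψ⟩·[Re⟨ψ, V(H−E₀)Vψ⟩ + (½Qt₀² + s)·Re⟨ψ, V²ψ⟩]`.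
[cite: KLS1988JSP, eqs. (12), (14), (18)–(19)] -/
theorem infraredBound_of_mulVec_eq_finiteSource (hH : H.IsHermitian) (hV : V.IsHermitian)
    (hψ : H *ᵥ ψ = (H.groundEnergy : ℂ) • ψ) (hcent : (star ψ ⬝ᵥ (V *ᵥ ψ)).re = 0) (ht₀ : t₀ ≠ 0)
    (hGDp : H.groundEnergy ≤
      (H + (t₀ : ℂ) • V + ((t₀ ^ 2 * Q / 2 + s : ℝ) : ℂ) • (1 : Matrix m m ℂ)).groundEnergy)
    (hGDm : H.groundEnergy ≤
      (H - (t₀ : ℂ) • V + ((t₀ ^ 2 * Q / 2 + s : ℝ) : ℂ) • (1 : Matrix m m ℂ)).groundEnergy) :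
    (star ψ ⬝ᵥ ((V * V) *ᵥ ψ)).re ^ 2 ≤
      (Q / 2 + s / t₀ ^ 2) * (star ψ ⬝ᵥ ψ).re *
        ((star ψ ⬝ᵥ ((V * (H - (H.groundEnergy : ℂ) • 1) * V) *ᵥ ψ)).re +
          (t₀ ^ 2 * Q / 2 + s) * (star ψ ⬝ᵥ ((V * V) *ᵥ ψ)).re) := by
  have hρ : (vecMulVec ψ (star ψ)).PosSemidef := posSemidef_vecMulVec_self_star ψ
  have hHρ : H * vecMulVec ψ (star ψ) = (H.groundEnergy : ℂ) • vecMulVec ψ (star ψ) := by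
    rw [mul_vecMulVec_eq', hψ, smul_vecMulVec]
  have hcent' : (vecMulVec ψ (star ψ) * V).trace.re = 0 := by
    rw [trace_vecMulVec_mul']; exact hcent
  have h := infraredBound_of_finiteSource hH hV hρ hHρ hcent' ht₀ hGDp hGDm
  rwa [trace_vecMulVec_mul', trace_vecMulVec_mul', trace_vecMulVec, dotProduct_comm ψ (star ψ)] at h

end Vector

/-! ### Assembly: the sum-rule step with certified per-mode ceilings (Kennedy–Lieb–Shastry (2)–(4) in finite volume)

Kennedy–Lieb–Shastry close the argument by a sum rule: integrating the two-point function over the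
Brillouin zone gives a model constant (`∫ g_q = S(S+1)/3`, eq. (2); `Σ_k S_pair(k)` = an on-site
norm for pair fields), so per-mode CEILINGS at the wave vectors `q ≠ Q` force the missing weight into
the ordering mode: `m² ≥ S(S+1)/3 − ∫ f_q` (eqs. (2), (4)). In finite volume and with finitely many
certified inputs this is bookkeeping over a finite family of modes `V_i`, `i ∈ s`, plus the ordering
mode `V_{i₀}`: a sum-rule FLOOR `S_tot ≤ Re tr(ρV_{i₀}²) + Σ_{i∈s} Re tr(ρV_i²)` and the per-mode
ceilings of `trace_sq_le_of_finiteSource` give the floor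
`Re tr(ρV_{i₀}²) ≥ S_tot − Σ_{i∈s} [½√(Q_eff,i·D_i) + ¼Q_eff,i(Q_i t_i² + 2s_i)]` on the ordering mode
in every centred ground-supported density matrix — from the finite certified data
`(t_i, Q_i, s_i, D_i)_{i∈s}` and `S_tot` alone. (The shape only; whether the right-hand side is
positive for a given model and volume is exactly the question of the size of the certified inputs.) -/

section Assembly
variable {H ρ : Matrix m m ℂ} {ι : Type*}

omit [DecidableEq m] in
/-- **Sum rule + per-mode ceilings ⇒ floor on the ordering mode** (pure bookkeeping): if
`S_tot ≤ Re tr(ρV_{i₀}²) + Σ_{i∈s} Re tr(ρV_i²)` and `Re tr(ρV_i²) ≤ u_i` for `i ∈ s`, then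
`S_tot − Σ_{i∈s} u_i ≤ Re tr(ρV_{i₀}²)`. [cite: KLS1988JSP, eqs. (2)–(4)] -/
theorem trace_orderingMode_ge_of_sumRule {V : ι → Matrix m m ℂ} {i₀ : ι} {s : Finset ι}
    {u : ι → ℝ} {Stot : ℝ}
    (hsum : Stot ≤ (ρ * (V i₀ * V i₀)).trace.re + ∑ i ∈ s, (ρ * (V i * V i)).trace.re)
    (hceil : ∀ i ∈ s, (ρ * (V i * V i)).trace.re ≤ u i) :
    Stot - ∑ i ∈ s, u i ≤ (ρ * (V i₀ * V i₀)).trace.re := by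
  have h := Finset.sum_le_sum hceil
  linarith

/-- **The finite-source infrared-bound certificate, assembled** (Kennedy–Lieb–Shastry's (2)–(4) with
(12)–(14) at finite source strengths): for a ground-supported density matrix `ρ` (`ρ ⪰ 0`,
`Hρ = E₀ρ`, `tr ρ = 1`), a finite family of centred Hermitian modes `V_i` (`i ∈ s`) each with its
certified data — source strength `t_i ≠ 0`, allowance `Q_i ≥ 0`, slack `s_i ≥ 0` with
`E₀(H) ≤ E₀(H ± t_iV_i) + ½t_i²Q_i + s_i`, and a double-commutator ceiling
`Re tr(ρ[V_i,[H,V_i]]) ≤ D_i` — and a sum-rule floor `S_tot ≤ Re tr(ρV_{i₀}²) + Σ_{i∈s} Re tr(ρV_i²)`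
for the ordering mode `V_{i₀}`, one has
`Re tr(ρV_{i₀}²) ≥ S_tot − Σ_{i∈s} [½√(Q_eff,i·D_i) + ¼·Q_eff,i·(Q_i t_i² + 2s_i)]`,
`Q_eff,i = Q_i + 2s_i/t_i²`. [cite: KLS1988JSP, eqs. (2)–(4), (12)–(14)] -/
theorem trace_orderingMode_ge_of_finiteSource (hH : H.IsHermitian) (hρ : ρ.PosSemidef)
    (hHρ : H * ρ = (H.groundEnergy : ℂ) • ρ) (htr : ρ.trace = 1)
    {V : ι → Matrix m m ℂ} {i₀ : ι} {s : Finset ι} {t Q sl D : ι → ℝ} {Stot : ℝ}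
    (hV : ∀ i ∈ s, (V i).IsHermitian) (hcent : ∀ i ∈ s, (ρ * V i).trace.re = 0)
    (ht : ∀ i ∈ s, t i ≠ 0) (hQ : ∀ i ∈ s, 0 ≤ Q i) (hsl : ∀ i ∈ s, 0 ≤ sl i)
    (hGDp : ∀ i ∈ s, H.groundEnergy ≤
      (H + (t i : ℂ) • V i + ((t i ^ 2 * Q i / 2 + sl i : ℝ) : ℂ) • (1 : Matrix m m ℂ)).groundEnergy)
    (hGDm : ∀ i ∈ s, H.groundEnergy ≤
      (H - (t i : ℂ) • V i + ((t i ^ 2 * Q i / 2 + sl i : ℝ) : ℂ) • (1 : Matrix m m ℂ)).groundEnergy)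
    (hD : ∀ i ∈ s, (ρ * (V i * (H * V i - V i * H) - (H * V i - V i * H) * V i)).trace.re ≤ D i)
    (hsum : Stot ≤ (ρ * (V i₀ * V i₀)).trace.re + ∑ i ∈ s, (ρ * (V i * V i)).trace.re) :
    Stot - ∑ i ∈ s, (Real.sqrt ((Q i + 2 * sl i / t i ^ 2) * D i) / 2 +
        (Q i + 2 * sl i / t i ^ 2) * (Q i * t i ^ 2 + 2 * sl i) / 4) ≤
      (ρ * (V i₀ * V i₀)).trace.re :=
  trace_orderingMode_ge_of_sumRule hsum fun i hi =>
    trace_sq_le_of_finiteSource hH (hV i hi) hρ hHρ htr (hcent i hi) (ht i hi) (hQ i hi) (hsl i hi)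
      (hGDp i hi) (hGDm i hi) (hD i hi)

end Assembly

end Literature.MathematicalPhysics.QuantumLattice
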